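import Summits.QuantumAdvantage.AdviceFreeQNC0.AffBells29ClassIso
import HarnessLib

/-!
# Sketch29 v3, part 4/5 (planner qn-p1 g29, ROUND-28): §29.6 THE TOGGLE — the pointwise half of `HClassB` (`act_toggle`, `toggle_classIso`, `toggle_unbalanced`, `cube_or_toggle`, … all PROVED)

(VERBATIM slice of `HOME/qa-qnc0-p1/exp29/Sketch29.lean` (sha16 `d7934601fa3f468f`, 1191 l., farm rc 0 / 0 sorry / 0 warnings), authored AND
proved by the planner seat qn-p1 g29; landed by the prover seat qn-prover-3 g14 (ask P-29b) as five files (400-line rule).  Changes: file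
boundaries with per-file preamble, one-line docstrings on undocumented auxiliaries (lint), and in part 1 the planner's re-proofs
`AffBells29.peeling/peelingList` are omitted in favour of the landed `AffBells28.peeling/peelingList` (gate dedup), as the ask allows.)
WHAT THIS IS NOT: `HClassA` (the one remaining c-free conjecture of the (NP₁) plan) is NOT touched; separation NOT moved.
-/

namespace Summit.QuantumAdvantage.AdviceFreeQNC0

namespace AffBells29

open Finset Literature.Computability.QuantumComplexity Literature.Computability.QuantumComplexity.RingHLF
open AffBells23 AffBells26 Fib19 AffBells27 AffBells28

variable {N : ℕ}

/-! ### §29.6 THE TOGGLE — the pointwise half of `HClassB` (PROVED)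

Let `u` be a free member of a class isolation at `(x, C₀)` and `P = {prv u, nxt u}` (two ACTIVE positions, hence outside `C₀`).  The pair-creation
move `x ↦ x ⊕ P` (`Fib19.kline_create`) stays in the odd class and turns the kernel line `J` into `J ⊕ e_u`: the active set loses exactly `u`, the
coins gain `u`.  Transporting the pattern point the same way (`x₁ ↦ x₁ ⊕ P`), the moves, their `dPair` readings, the survivors other than `u` and
the free coins are unchanged (`toggle_classIso`), and the effective offsets of all remaining members shift by the SAME amount
`s = dPair β x₁ g (prv u) (nxt u)` (the class is `±`-twin to `g` on `P`), so the three groups are relabelled by `t ↦ t + s` and lose the one element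
`u`: a BALANCED class becomes UNBALANCED (`toggle_unbalanced`) and, by `cube_of_unbalanced'`, the image window carries a cube witness for the same
`c`.  What remains of `HClassB` is the weighted re-indexing `(x, C₀) ↦ (x ⊕ P, C₀)` (fibres `≤ N` over the choice of `u`, weight loss `≤ Z+1` by
`StableLaw`) — a double count with no probability in it. -/

/-- The toggle on the active set: exactly `u` leaves. -/
theorem act_toggle (hN : 4 ≤ N) {x : Fin N → Bool} (hx : IsOdd x) {u : Fin N} (hu : kline x u = true) (hp : kline x (prv u) = true)
    (hn : kline x (nxt u) = true) : IsOdd (flipAt x {prv u, nxt u}) ∧ act (flipAt x {prv u, nxt u}) = (act x).erase u := by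
  obtain ⟨hodd, hk⟩ := kline_create hN x hx u hp hu hn
  refine ⟨hodd, ?_⟩
  ext g
  unfold act
  rw [mem_erase, mem_filter, mem_filter, hk]
  unfold flipAt
  by_cases hg : g = u
  · subst hg
    simp [hu]
  · simp [hg]

/-- The window stays a set of coins after the toggle. -/
theorem subset_klineZeros_toggle (hN : 4 ≤ N) {x : Fin N → Bool} (hx : IsOdd x) {u : Fin N} (hu : kline x u = true)
    (hp : kline x (prv u) = true) (hn : kline x (nxt u) = true) {C₀ : Finset (Fin N)} (hC₀ : C₀ ⊆ klineZeros x) :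
    C₀ ⊆ klineZeros (flipAt x {prv u, nxt u}) := by
  obtain ⟨-, hk⟩ := kline_create hN x hx u hp hu hn
  intro i hi
  have hz : kline x i = false := by
    have := hC₀ hi
    unfold klineZeros at this
    exact (mem_filter.1 this).2
  have hiu : i ≠ u := by
    rintro rfl
    rw [hz] at hu
    exact Bool.false_ne_true hu
  unfold klineZeros
  rw [mem_filter, hk]
  refine ⟨mem_univ _, ?_⟩
  unfold flipAt
  simp [hz, hiu]

/-- The pattern point is transported along with the base point. -/
theorem toggle_mem_subFibre (hN : 4 ≤ N) {x x₁ : Fin N → Bool} {C₀ : Finset (Fin N)} (hx : IsOdd x) (hx₁ : x₁ ∈ SubFibre x C₀) {u : Fin N}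
    (hu : kline x u = true) (hp : kline x (prv u) = true) (hn : kline x (nxt u) = true) :
    flipAt x₁ {prv u, nxt u} ∈ SubFibre (flipAt x {prv u, nxt u}) C₀ := by
  have h := hx₁
  unfold SubFibre at h ⊢
  rw [mem_filter] at h ⊢
  obtain ⟨-, hodd₁, hk₁, hagree⟩ := h
  obtain ⟨-, hk⟩ := kline_create hN x hx u hp hu hn
  obtain ⟨hodd₁', hk₁'⟩ := kline_create hN x₁ hodd₁ u (by rw [hk₁]; exact hp) (by rw [hk₁]; exact hu) (by rw [hk₁]; exact hn)
  refine ⟨mem_univ _, hodd₁', ?_, ?_⟩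
  · rw [hk₁', hk, hk₁]
  · intro i hi
    unfold flipAt
    rw [hagree i hi]

/-- Active positions are not window coins. -/
theorem not_mem_of_active {x : Fin N → Bool} {C₀ : Finset (Fin N)} (hC₀ : C₀ ⊆ klineZeros x) {i : Fin N} (hi : kline x i = true) : i ∉ C₀ := by
  intro h
  have := hC₀ h
  unfold klineZeros at this
  rw [(mem_filter.1 this).2] at hi
  exact Bool.false_ne_true hi

/-- Move readings do not see the toggle (the moves live in `C₀`, the flipped positions are active). -/
theorem toggle_moves_agree {x x₁ : Fin N → Bool} {C₀ : Finset (Fin N)} (hC₀ : C₀ ⊆ klineZeros x) {L : List (Fin N × Fin N)}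
    (hL : MovesIn C₀ L) {u : Fin N} (hp : kline x (prv u) = true) (hn : kline x (nxt u) = true) :
    ∀ q ∈ L, flipAt x₁ {prv u, nxt u} q.1 = x₁ q.1 ∧ flipAt x₁ {prv u, nxt u} q.2 = x₁ q.2 := by
  intro q hq
  have h1 : q.1 ∈ C₀ := (hL.1 q hq).1
  have h2 : q.2 ∈ C₀ := (hL.1 q hq).2
  have hp' := not_mem_of_active hC₀ hp
  have hn' := not_mem_of_active hC₀ hn
  have n1 : q.1 ∉ ({prv u, nxt u} : Finset (Fin N)) := by
    simp only [mem_insert, mem_singleton, not_or]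
    exact ⟨fun e => hp' (e ▸ h1), fun e => hn' (e ▸ h1)⟩
  have n2 : q.2 ∉ ({prv u, nxt u} : Finset (Fin N)) := by
    simp only [mem_insert, mem_singleton, not_or]
    exact ⟨fun e => hp' (e ▸ h2), fun e => hn' (e ▸ h2)⟩
  exact ⟨flipAt_apply_of_not_mem n1, flipAt_apply_of_not_mem n2⟩

/-- **TOGGLE, structure half (PROVED):** the class isolation survives with `u` removed from the survivors; offsets-after-peeling unchanged. -/
theorem toggle_classIso (hN : 4 ≤ N) {β : Fin N → Fin N → ZMod 3} {x x₁ : Fin N → Bool} {C₀ : Finset (Fin N)} {L : List (Fin N × Fin N)}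
    {g u : Fin N} (hx : IsOdd x) (hC₀ : C₀ ⊆ klineZeros x) (h : IsClassIso β x C₀ x₁ L g) (hu : u ∈ surv β x x₁ L) (hug : u ≠ g)
    (hp : kline x (prv u) = true) (hn : kline x (nxt u) = true) (c : Fin N → ZMod 3) :
    IsClassIso β (flipAt x {prv u, nxt u}) C₀ (flipAt x₁ {prv u, nxt u}) L g ∧
      surv β (flipAt x {prv u, nxt u}) (flipAt x₁ {prv u, nxt u}) L = (surv β x x₁ L).erase u ∧
      cShift β c (flipAt x₁ {prv u, nxt u}) L = cShift β c x₁ L := by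
  obtain ⟨hx₁, hL0, hL, hg, htw, hfree⟩ := h
  have hua : kline x u = true := by
    have := hu
    unfold surv act at this
    rw [mem_filter, mem_filter] at this
    exact this.1.2
  have hagree := toggle_moves_agree (x₁ := x₁) hC₀ hL hp hn
  have hact := (act_toggle hN hx hua hp hn).2
  have hsurv : surv β (flipAt x {prv u, nxt u}) (flipAt x₁ {prv u, nxt u}) L = (surv β x x₁ L).erase u := by
    rw [surv_congr β (flipAt x {prv u, nxt u}) hagree]
    unfold surv
    rw [hact, filter_erase]
  have hcs := cShift_congr β c hagree
  refine ⟨⟨toggle_mem_subFibre hN hx hx₁ hua hp hn, hL0, hL, ?_, ?_, hfree⟩, hsurv, hcs⟩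
  · rw [hsurv, mem_erase]
    exact ⟨hug.symm, hg⟩
  · intro k hk
    rw [hsurv, mem_erase] at hk
    exact htw k hk.2

/-- Twin sign on the free coins is determined by the sign on a larger set (g reads a free coin non-trivially). -/
theorem tsign_of_twin {β : Fin N → Fin N → ZMod 3} {F F' : Finset (Fin N)} (hFF : F ⊆ F') {h g : Fin N} (ht : LocTwin β F' h g) :
    tsign β F h g = 1 := by
  unfold tsign
  rw [if_pos (fun i hi => ht i (hFF hi))]

/-- Auxiliary step `tsign_of_anti` of Sketch29 (planner qa-qnc0-p1 g29, v3, verbatim). -/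
theorem tsign_of_anti {β : Fin N → Fin N → ZMod 3} {F F' : Finset (Fin N)} (hFF : F ⊆ F') {h g r : Fin N} (hr : r ∈ F) (hgr : β g r ≠ 0)
    (ha : LocAnti β F' h g) : tsign β F h g = -1 := by
  unfold tsign
  rw [if_neg]
  intro ht
  have h1 := ht r hr
  have h2 := ha r (hFF hr)
  rw [h1] at h2
  apply hgr
  revert h2
  generalize β g r = v
  revert v
  decide

/-- **TOGGLE, parity half (PROVED):** with all remaining members `±`-twin to `g` at `prv u, nxt u` (same sign as on the free coins), the three
groups are relabelled by the common shift and lose the single element `u`; a balanced class becomes unbalanced. -/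
theorem toggle_unbalanced (hN : 3 ≤ N) {β : Fin N → Fin N → ZMod 3} (c : Fin N → ZMod 3) {x x' x₁ : Fin N → Bool} {C₀ : Finset (Fin N)}
    {L : List (Fin N × Fin N)} {g u : Fin N} (h : IsClassIso β x C₀ x₁ L g) (hu : u ∈ surv β x x₁ L)
    (htw : ∀ k ∈ surv β x x₁ L, k ≠ u → LocTwin β (insert (prv u) (insert (nxt u) (C₀ \ moveCoins L))) k g ∨
      LocAnti β (insert (prv u) (insert (nxt u) (C₀ \ moveCoins L))) k g)
    (hsurv : surv β x' (flipAt x₁ {prv u, nxt u}) L = (surv β x x₁ L).erase u)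
    (hcs : cShift β c (flipAt x₁ {prv u, nxt u}) L = cShift β c x₁ L) (hb : Balanced β c x x₁ L C₀ g) :
    ¬ Balanced β c x' (flipAt x₁ {prv u, nxt u}) L C₀ g := by
  obtain ⟨-, -, -, -, -, r, hr, r', hr', r'', hr'', -, -, -, hgr, -, -⟩ := h
  set F := C₀ \ moveCoins L with hF
  set F' := insert (prv u) (insert (nxt u) F) with hF'
  have hFF : F ⊆ F' := fun i hi => mem_insert_of_mem (mem_insert_of_mem hi)
  have hpF : prv u ∈ F' := mem_insert_self _ _
  have hnF : nxt u ∈ F' := mem_insert_of_mem (mem_insert_self _ _)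
  set s := dPair β x₁ g (prv u) (nxt u) with hs
  -- the shift lemma: Δ'_k = Δ_k - s for every remaining member
  have hFe : ∀ k ∈ surv β x x₁ L, k ≠ u → tsign β F k g = tsign β F' k g := by
    intro k hk hku
    rcases htw k hk hku with ht | ha
    · rw [tsign_of_twin hFF ht, tsign_of_twin (subset_refl _) ht]
    · rw [tsign_of_anti hFF hr hgr ha, tsign_of_anti (subset_refl _) (hFF hr) hgr ha]
  have hshift : ∀ k ∈ surv β x x₁ L, k ≠ u →
      tsign β F k g * (cShift β c x₁ L k - form β (flipAt x₁ {prv u, nxt u}) k) =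
        tsign β F k g * (cShift β c x₁ L k - form β x₁ k) - s := by
    intro k hk hku
    rw [form_flipAt_pair β x₁ k (prv_ne_nxt hN u), dPair_tsign β x₁ (F := F') (htw k hk hku) hpF hnF, ← hFe k hk hku]
    have hsq := tsign_sq β F k g
    generalize tsign β F k g = t at hsq ⊢
    linear_combination (-s) * hsq
  -- the new groups: grp' t + [Δ_u = t + s] = grp (t + s)
  have hgrp : ∀ t : ZMod 3,
      grp β c x' (flipAt x₁ {prv u, nxt u}) L C₀ g t +
        (if tsign β F u g * (cShift β c x₁ L u - form β x₁ u) = t + s then 1 else 0) = grp β c x x₁ L C₀ g (t + s) := by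
    intro t
    unfold grp
    rw [hsurv, hcs]
    have hcong : (((surv β x x₁ L).erase u).filter fun k => tsign β (C₀ \ moveCoins L) k g *
        (cShift β c x₁ L k - form β (flipAt x₁ {prv u, nxt u}) k) = t) =
        (((surv β x x₁ L).erase u).filter fun k => tsign β (C₀ \ moveCoins L) k g * (cShift β c x₁ L k - form β x₁ k) = t + s) := by
      refine filter_congr fun k hk => ?_
      rw [mem_erase] at hk
      rw [← hF, hshift k hk.2 hk.1]
      exact sub_eq_iff_eq_add
    rw [hcong, filter_erase]
    by_cases hmem : tsign β F u g * (cShift β c x₁ L u - form β x₁ u) = t + s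
    · rw [if_pos hmem]
      apply card_erase_add_one
      rw [mem_filter]
      exact ⟨hu, by rw [← hF]; exact hmem⟩
    · rw [if_neg hmem, add_zero, erase_eq_of_notMem]
      rw [mem_filter, not_and]
      intro _
      rw [← hF]
      exact hmem
  -- parity bookkeeping
  intro hb'
  have three : ∀ w : ZMod 3, w = 0 ∨ w = 1 ∨ w = 2 := by decide
  have hall : ∀ w : ZMod 3, grp β c x x₁ L C₀ g w % 2 = grp β c x x₁ L C₀ g 0 % 2 := by
    intro w
    unfold Balanced at hb
    rcases three w with rfl | rfl | rfl
    · rfl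
    · exact hb.1.symm
    · rw [← hb.2, hb.1]
  have hall' : ∀ w : ZMod 3, grp β c x' (flipAt x₁ {prv u, nxt u}) L C₀ g w % 2 = grp β c x' (flipAt x₁ {prv u, nxt u}) L C₀ g 0 % 2 := by
    intro w
    unfold Balanced at hb'
    rcases three w with rfl | rfl | rfl
    · rfl
    · exact hb'.1.symm
    · rw [← hb'.2, hb'.1]
  set Δu := tsign β F u g * (cShift β c x₁ L u - form β x₁ u) with hΔu
  have h0 := hgrp (Δu - s)
  have h1 := hgrp (Δu - s + 1)
  rw [if_pos (by ring)] at h0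
  rw [if_neg (by
    intro h
    have : (1 : ZMod 3) = 0 := by linear_combination -h
    exact absurd this (by decide))] at h1
  have e0 := hall (Δu - s + s)
  have e1 := hall (Δu - s + 1 + s)
  have f0 := hall' (Δu - s)
  have f1 := hall' (Δu - s + 1)
  omega

/-- **TOGGLE ⇒ CUBE WITNESS at the image window (PROVED):** a balanced class isolation with a free member `u` yields, after making `u` a coin,
a cube witness for the SAME offsets `c` on the SAME window `C₀`. -/
theorem cube_of_toggle (hN : 4 ≤ N) (β : Fin N → Fin N → ZMod 3) (c : Fin N → ZMod 3) {x x₁ : Fin N → Bool} {C₀ : Finset (Fin N)}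
    {L : List (Fin N × Fin N)} {g u : Fin N} (hx : IsOdd x) (hC₀ : C₀ ⊆ klineZeros x) (h : IsClassIso β x C₀ x₁ L g)
    (hu : u ∈ surv β x x₁ L) (hug : u ≠ g) (hp : kline x (prv u) = true) (hn : kline x (nxt u) = true)
    (htw : ∀ k ∈ surv β x x₁ L, k ≠ u → LocTwin β (insert (prv u) (insert (nxt u) (C₀ \ moveCoins L))) k g ∨
      LocAnti β (insert (prv u) (insert (nxt u) (C₀ \ moveCoins L))) k g)
    (hb : Balanced β c x x₁ L C₀ g) :
    IsOdd (flipAt x {prv u, nxt u}) ∧ C₀ ⊆ klineZeros (flipAt x {prv u, nxt u}) ∧ CubeWitness β c (flipAt x {prv u, nxt u}) C₀ := by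
  have hua : kline x u = true := by
    have := hu
    unfold surv act at this
    rw [mem_filter, mem_filter] at this
    exact this.1.2
  obtain ⟨hiso, hsurv, hcs⟩ := toggle_classIso hN hx hC₀ h hu hug hp hn c
  have hC₀' := subset_klineZeros_toggle hN hx hua hp hn hC₀
  refine ⟨(act_toggle hN hx hua hp hn).1, hC₀', ?_⟩
  exact cube_of_unbalanced' (by omega) β c hC₀' hiso (toggle_unbalanced (by omega) c h hu htw hsurv hcs hb)

/-- **THE DICHOTOMY AT A `ClassIsoFM` WINDOW (PROVED):** either the window itself carries a cube witness, or the toggled window does. -/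
theorem cube_or_toggle (hN : 4 ≤ N) (β : Fin N → Fin N → ZMod 3) (c : Fin N → ZMod 3) {x : Fin N → Bool} {C₀ : Finset (Fin N)}
    (hx : IsOdd x) (hC₀ : C₀ ⊆ klineZeros x) (h : ClassIsoFM β c x C₀) :
    CubeWitness β c x C₀ ∨ ∃ u : Fin N, kline x u = true ∧ kline x (prv u) = true ∧ kline x (nxt u) = true ∧
      IsOdd (flipAt x {prv u, nxt u}) ∧ C₀ ⊆ klineZeros (flipAt x {prv u, nxt u}) ∧ CubeWitness β c (flipAt x {prv u, nxt u}) C₀ := by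
  obtain ⟨x₁, L, g, hiso, hs | ⟨u, hu, hug, hp, hn, htw⟩⟩ := h
  · exact Or.inl (cube_of_single' (by omega) β hC₀ hiso hs c)
  by_cases hb : Balanced β c x x₁ L C₀ g
  · right
    have hua : kline x u = true := by
      have := hu
      unfold surv act at this
      rw [mem_filter, mem_filter] at this
      exact this.1.2
    exact ⟨u, hua, hp, hn, cube_of_toggle hN β c hx hC₀ hiso hu hug hp hn htw hb⟩
  · left
    exact cube_of_unbalanced' (by omega) β c hC₀ hiso hb

end AffBells29

end Summit.QuantumAdvantage.AdviceFreeQNC0
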